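import Mathlib
import HarnessLib
import Summits.AtomisticToContinuum.Crystallization.Theorems.PricedLinkCensusSoftLayerPropagationStubBallPropagationCaseA

/-!
# The finite-ball form of Hales, *Dense Sphere Packings* §1.3 — Case B and the stub

Route `PricedLinkCensus`, crux `SoftLayerPropagation` (stmt-AtomisticToContinuum-14233), line
`Sketch`, stub `stub_ballPropagation` (η = 0, vocabulary of `FejesTothKissingTwelve.lean`).

CASE B: no centre within `15/2` of `u` has an HCP shell.  Then every centre within `15/2` is
FCC-arranged; frame at `u` itself, FCC base disc of radius `15/2` (`fcc_disc`, types made uniform by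
`lattice_disc_induction` and `holeTriple_type_eq_of_adjacent_dir`), five layers up and five down
with the FCC schedule (the first two inside the FCC zone, no far corner; then the far corner),
splice and no room as in Case A.  THE STUB: Case A with an almost-nearest HCP centre chosen by
minimising `⌊3 · dist²⌋` (`Nat.find`), else Case B.
-/

noncomputable section

namespace Summit.AtomisticToContinuum.Crystallization.Theorems

open Literature.Geometry.DiscreteGeometry Literature.MathematicalPhysics.StatisticalMechanics
open RealInnerProductSpace

/-! ### Case B -/

/-- **Case B of the finite-ball statement.**  If no centre within `15/2` of the centre `u` has an
HCP shell, then `V ∩ closedBall u 7` is a moved close-packed Barlow stacking cut to the ball (in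
fact a moved FCC lattice). [cite: HalesDSP2012, §1.3] -/
theorem caseB {V : Set (EuclideanSpace ℝ (Fin 3))} (hV : IsUnitBallPacking V) {u : EuclideanSpace ℝ (Fin 3)}
    (hu : u ∈ V)
    (hpat : ∀ v ∈ V, dist u v ≤ 13 →
      IsArrangedIn (kissingShell V v) fccKissingPattern ∨ IsArrangedIn (kissingShell V v) hcpKissingPattern)
    (hno : ∀ v ∈ V, dist u v ≤ 15 / 2 → ¬ IsArrangedIn (kissingShell V v) hcpKissingPattern) :
    ∃ s : ℤ → ℤ, IsHaggSeq s ∧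
      ∃ g : EuclideanSpace ℝ (Fin 3) ≃ᵢ EuclideanSpace ℝ (Fin 3),
        V ∩ Metric.closedBall u 7 =
          g '' barlowStacking 2 (2 * Real.sqrt (2 / 3)) s ∩ Metric.closedBall u 7 := by
  have hfccu : IsArrangedIn (kissingShell V u) fccKissingPattern :=
    (hpat u hu (by simp)).resolve_right (hno u hu (by rw [dist_self]; norm_num))
  obtain ⟨L, σ, hσ, hshell0⟩ := exists_frame_of_fcc_centre hV hfccu
  have hnσ : -σ = 1 ∨ -σ = -1 := by rcases hσ with rfl | rfl <;> norm_num
  set V' : Set (EuclideanSpace ℝ (Fin 3)) := {x | u + L x ∈ V} with hV'def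
  have hV' : IsUnitBallPacking V' := hV.preimage u L
  have h0V : (0 : EuclideanSpace ℝ (Fin 3)) ∈ V' := by simp [hV'def, hu]
  have hu' : L.symm (u - u) = 0 := by simp
  have hpat' : ∀ x ∈ V', dist x 0 ≤ 13 →
      IsArrangedIn (kissingShell V' x) fccKissingPattern ∨ IsArrangedIn (kissingShell V' x) hcpKissingPattern := by
    have := isArrangedIn_preimage_of_ball hpat u L
    rw [hu'] at this; exact this
  have hfcc' : ∀ x ∈ V', dist x 0 ≤ 15 / 2 → IsArrangedIn (kissingShell V' x) fccKissingPattern := by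
    intro x hx hd
    have hd' : dist u (u + L x) ≤ 15 / 2 := by rw [← dist_frame_eq L x, hu']; exact hd
    refine (hpat' x hx (by linarith)).resolve_right fun hh => hno (u + L x) hx hd' ?_
    rw [kissingShell_eq_image_of_frame]; exact IsArrangedIn.image_equiv hh L
  have hc2 : (0 : EuclideanSpace ℝ (Fin 3)) 2 = 0 := rfl
  -- patterns and zone from the horizontal foot and the height
  have dist_of : ∀ (y : EuclideanSpace ℝ (Fin 3)) (t P B : ℝ), y 2 = t * layerSpacing →
      ‖y - ((0 : EuclideanSpace ℝ (Fin 3)) + t • layerNormal layerSpacing)‖ ≤ P → 0 ≤ P → 0 ≤ B →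
      P ^ 2 + 8 / 3 * t ^ 2 ≤ B ^ 2 → dist y 0 ≤ B := by
    intro y t P B hy hP hP0 hB0 hle
    have hor : (y - ((0 : EuclideanSpace ℝ (Fin 3)) + t • layerNormal layerSpacing)) 2 = 0 := by simp [hy]
    have e : y = (y - ((0 : EuclideanSpace ℝ (Fin 3)) + t • layerNormal layerSpacing)) + t • layerNormal layerSpacing := by
      simp
    have h1 : dist y 0 ^ 2 ≤ B ^ 2 := by
      rw [dist_zero_right]
      conv_lhs => rw [e]
      rw [norm_sq_add_smul_frameE hor]
      nlinarith [norm_nonneg (y - ((0 : EuclideanSpace ℝ (Fin 3)) + t • layerNormal layerSpacing))]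
    exact (pow_le_pow_iff_left₀ dist_nonneg hB0 two_ne_zero).1 h1
  -- the FCC base disc of radius `15/2`, with uniform types
  have hdisc := fcc_disc (V := V') hc2 (R := 15 / 2)
    (fun i j hij hmem => hfcc' _ hmem (by rw [dist_zero_right]; simpa using hij))
    (i₀ := 0) (j₀ := 0) (by simp) (by simpa using h0V) (by simp only [Int.cast_zero, zero_smul, add_zero]; rw [hshell0]; exact hexagonSet_subset_layerShell _ _)
  have hbase : ∀ i j : ℤ,
      ‖((i : ℝ) • (triangularVec₁ 2 : EuclideanSpace ℝ (Fin 3)) + (j : ℝ) • triangularVec₂ 2) - 0‖ ≤ 15 / 2 →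
      (i : ℝ) • (triangularVec₁ 2 : EuclideanSpace ℝ (Fin 3)) + (j : ℝ) • triangularVec₂ 2 ∈ V' ∧
      kissingShell V' ((i : ℝ) • (triangularVec₁ 2 : EuclideanSpace ℝ (Fin 3)) + (j : ℝ) • triangularVec₂ 2)
        = layerShell σ (-σ) := by
    refine lattice_disc_induction hc2 (Q := fun i j =>
      (i : ℝ) • (triangularVec₁ 2 : EuclideanSpace ℝ (Fin 3)) + (j : ℝ) • triangularVec₂ 2 ∈ V' ∧
      kissingShell V' ((i : ℝ) • (triangularVec₁ 2 : EuclideanSpace ℝ (Fin 3)) + (j : ℝ) • triangularVec₂ 2)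
        = layerShell σ (-σ)) ?_ (i₀ := 0) (j₀ := 0) (by simp) ⟨by simpa using h0V, by simpa using hshell0⟩
    rintro i j ⟨hPV, hPshell⟩ η hη i' j' he hR
    obtain ⟨hP'V, hH'⟩ := hdisc i' j' hR
    have hpatP' := hpat' _ hP'V (by rw [dist_zero_right]; have := hR; simp only [sub_zero] at this; linarith)
    obtain ⟨τ, τ', hτ, hτ', hS'⟩ := (isTwelveConfig_kissingShell_of_isArrangedIn hV' hpatP').eq_layerShell hH'
    refine ⟨hP'V, ?_⟩
    rw [he] at hS' ⊢
    have hup : ∀ t ∈ holeTriple σ, t + (1 : ℝ) • layerNormal layerSpacing ∈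
        kissingShell V' ((i : ℝ) • (triangularVec₁ 2 : EuclideanSpace ℝ (Fin 3)) + (j : ℝ) • triangularVec₂ 2) :=
      fun t ht => by rw [hPshell, one_smul]; exact mem_layerShell_iff.2 (Or.inr (Or.inl (by simpa using ht)))
    have hup' : ∀ t ∈ holeTriple τ, t + (1 : ℝ) • layerNormal layerSpacing ∈
        kissingShell V' ((i : ℝ) • (triangularVec₁ 2 : EuclideanSpace ℝ (Fin 3)) + (j : ℝ) • triangularVec₂ 2 + η) :=
      fun t ht => by rw [hS', one_smul]; exact mem_layerShell_iff.2 (Or.inr (Or.inl (by simpa using ht)))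
    have hdn : ∀ t ∈ holeTriple (-σ), t + (-1 : ℝ) • layerNormal layerSpacing ∈
        kissingShell V' ((i : ℝ) • (triangularVec₁ 2 : EuclideanSpace ℝ (Fin 3)) + (j : ℝ) • triangularVec₂ 2) :=
      fun t ht => by
        rw [hPshell, neg_one_smul, ← sub_eq_add_neg]
        exact mem_layerShell_iff.2 (Or.inr (Or.inr (by simpa using ht)))
    have hdn' : ∀ t ∈ holeTriple τ', t + (-1 : ℝ) • layerNormal layerSpacing ∈
        kissingShell V' ((i : ℝ) • (triangularVec₁ 2 : EuclideanSpace ℝ (Fin 3)) + (j : ℝ) • triangularVec₂ 2 + η) :=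
      fun t ht => by
        rw [hS', neg_one_smul, ← sub_eq_add_neg]
        exact mem_layerShell_iff.2 (Or.inr (Or.inr (by simpa using ht)))
    have h1 := holeTriple_type_eq_of_adjacent_dir hV' hη hσ hτ hup hup'
    have h2 := holeTriple_type_eq_of_adjacent_dir hV' hη hnσ hτ' hdn hdn'
    rw [hS', h1, h2]
  -- the schedule (the same above and below)
  obtain ⟨P, R, hP0, hP2, hR, hpar, hfar, hzoneP, hgoodP, hcov⟩ := exists_fcc_schedule'
  have hbase' : ∀ i j : ℤ,
      ‖((i : ℝ) • (triangularVec₁ 2 : EuclideanSpace ℝ (Fin 3)) + (j : ℝ) • triangularVec₂ 2) - 0‖ ≤ P 0 → _ :=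
    fun i j h => hbase i j (by rw [hP0] at h; exact h)
  have hP0' : ∀ n ≤ 5, 0 ≤ P n := fun n hn => (Real.sqrt_nonneg 2).trans (hP2 n hn).1
  have hzone_hyp : ∀ (sgn : ℝ), (sgn = 1 ∨ sgn = -1) → ∀ n : ℕ, n < 5 →
      (∀ y ∈ V', y 2 = sgn * (((n : ℝ) + 1) * layerSpacing) →
        ‖y - ((0 : EuclideanSpace ℝ (Fin 3)) + (sgn * ((n : ℝ) + 1)) • layerNormal layerSpacing)‖ ≤ P (n + 1) →
        dist y 0 ≤ 15 / 2) ∨ P (n + 1) + 4 / Real.sqrt 3 ≤ R n := by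
    intro sgn hsgn n hn
    have hsgn2 : sgn ^ 2 = 1 := by rcases hsgn with rfl | rfl <;> norm_num
    rcases Nat.lt_or_ge n 2 with h2 | h2
    · left
      intro y hy hy2 hyd
      refine dist_of y (sgn * ((n : ℝ) + 1)) (P (n + 1)) (15 / 2) (by rw [hy2]; ring) hyd (hP0' _ (by omega))
        (by norm_num) ?_
      have := hzoneP n h2 (P (n + 1)) le_rfl (hP0' _ (by omega))
      rw [mul_pow, hsgn2, one_mul]; exact this
    · exact Or.inr (hfar n h2 hn)
  have hgood_hyp : ∀ (sgn : ℝ), (sgn = 1 ∨ sgn = -1) → ∀ n : ℕ, n < 5 → ∀ y ∈ V',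
      y 2 = sgn * (((n : ℝ) + 1) * layerSpacing) →
      ‖y - ((0 : EuclideanSpace ℝ (Fin 3)) + (sgn * ((n : ℝ) + 1)) • layerNormal layerSpacing)‖ ≤ P (n + 1) →
      dist y 0 ≤ 13 := by
    intro sgn hsgn n hn y hy hy2 hyd
    have hsgn2 : sgn ^ 2 = 1 := by rcases hsgn with rfl | rfl <;> norm_num
    refine dist_of y (sgn * ((n : ℝ) + 1)) (P (n + 1)) 13 (by rw [hy2]; ring) hyd (hP0' _ (by omega))
      (by norm_num) ?_
    have := hgoodP n hn (P (n + 1)) le_rfl (hP0' _ (by omega))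
    rw [mul_pow, hsgn2, one_mul]; linarith
  -- the layers above and below
  obtain ⟨sp, sp0, hsp, hAup⟩ := layers_up hV' hc2 (fun y => dist y 0 ≤ 13) (fun y => dist y 0 ≤ 15 / 2)
    (fun y hy hg => hpat' y hy hg) (fun y hy hz => hfcc' y hy hz) 5 P R
    (fun n hn => (hP2 n hn).1) (fun n hn => hR n (by omega)) (fun n hn => hpar n hn)
    (fun n hn y hy hy2 hyd => hgood_hyp 1 (Or.inl rfl) n hn y hy (by rw [hy2]; ring) (by simpa using hyd))
    (fun n hn => by
      rcases hzone_hyp 1 (Or.inl rfl) n hn with h | h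
      · exact Or.inl fun y hy hy2 hyd => h y hy (by rw [hy2]; ring) (by simpa using hyd)
      · exact Or.inr h)
    hσ (i₀ := 0) (j₀ := 0) (by simp) hbase'
  obtain ⟨sm, sm0, hsm, hAdn⟩ := layers_down hV' hc2 (fun y => dist y 0 ≤ 13) (fun y => dist y 0 ≤ 15 / 2)
    (fun y hy hg => hpat' y hy hg) (fun y hy hz => hfcc' y hy hz) 5 P R
    (fun n hn => (hP2 n hn).1) (fun n hn => hR n (by omega)) (fun n hn => hpar n hn)
    (fun n hn y hy hy2 hyd => hgood_hyp (-1) (Or.inr rfl) n hn y hy (by rw [hy2]; ring)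
      (by rw [neg_one_mul, neg_smul, ← sub_eq_add_neg]; exact hyd))
    (fun n hn => by
      rcases hzone_hyp (-1) (Or.inr rfl) n hn with h | h
      · exact Or.inl fun y hy hy2 hyd => h y hy (by rw [hy2]; ring)
          (by rw [neg_one_mul, neg_smul, ← sub_eq_add_neg]; exact hyd)
      · exact Or.inr h)
    hnσ (i₀ := 0) (j₀ := 0) (by simp) hbase'
  -- the Hägg sequence and the stacking points
  obtain ⟨sZ, hsZ, hLp, hLm, -, -⟩ := exists_haggSeq_of_signs sp sm hsp hsm
  obtain ⟨memUp, memDn⟩ := barlowPos_mem_of_layers (V := V') hc2 5 5 P R P R hP0' hP0'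
    (fun n hn => hR n hn) (fun n hn => hR n hn) sZ sp sm hLp hLm hbase' hAup hAdn
  clear hAup hAdn hbase' hbase hdisc hgood_hyp hzone_hyp hzoneP hgoodP hpar hfar hpat hpat' hfcc' hno dist_of
  refine exists_isometry_inter_closedBall_eq_of_frame_sharp hV u L u 7 hsZ (fun k i j hd => ?_)
  show barlowPos 2 layerSpacing sZ k i j ∈ V'
  rw [hu'] at hd
  obtain ⟨yh, hyh⟩ : ∃ yh : EuclideanSpace ℝ (Fin 3), yh = (i : ℝ) • (triangularVec₁ 2 : EuclideanSpace ℝ (Fin 3)) +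
      (j : ℝ) • triangularVec₂ 2 + ((haggLabel sZ k : ℤ) : ℝ) • barlowOffset 2 := ⟨_, rfl⟩
  have hy : barlowPos 2 layerSpacing sZ k i j = yh + (k : ℝ) • layerNormal layerSpacing := by
    rw [hyh]; rfl
  have hor : (yh - 0) 2 = 0 := by rw [hyh]; simp
  have hdist : ‖yh - 0‖ ^ 2 + 8 / 3 * ((k : ℝ)) ^ 2 ≤ 73.34 := by
    have e : barlowPos 2 layerSpacing sZ k i j - 0 = (yh - 0) + (k : ℝ) • layerNormal layerSpacing := by
      rw [hy]; module
    have h1 : dist (barlowPos 2 layerSpacing sZ k i j) 0 ^ 2 ≤ 73.34 :=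
      (pow_le_pow_left₀ dist_nonneg hd 2).trans seven_add_sqrt_sq_le
    rw [dist_eq_norm, e, norm_sq_add_smul_frameE hor] at h1
    exact h1
  have hka : ((k : ℝ)) ^ 2 ≤ 5.2443 ^ 2 := by nlinarith [norm_nonneg (yh - 0)]
  have hka' := abs_le_of_sq_le_sq' hka (by norm_num)
  rcases le_or_gt 0 k with hk | hk
  · have ek : ((k.toNat : ℕ) : ℤ) = k := Int.toNat_of_nonneg hk
    have ekr : ((k.toNat : ℕ) : ℝ) = (k : ℝ) := by exact_mod_cast ek
    have h5 : k.toNat ≤ 5 := by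
      have : (k.toNat : ℝ) < 6 := by rw [ekr]; linarith only [hka'.2]
      exact_mod_cast Nat.lt_succ_iff.mp (by exact_mod_cast this : k.toNat < 6)
    have hcov' := hcov k.toNat h5 (‖yh - 0‖ ^ 2) (by rw [ekr]; exact hdist)
    have hR0 : 0 ≤ R k.toNat := (hP0' _ h5).trans (hP2 _ h5).2
    have hle : ‖yh - 0‖ ≤ R k.toNat := (pow_le_pow_iff_left₀ (norm_nonneg _) hR0 two_ne_zero).1 hcov'
    have := memUp k.toNat h5 i j (by rw [ek, ← hyh]; exact hle)
    rwa [ek] at this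
  · have ek : (((-k).toNat : ℕ) : ℤ) = -k := Int.toNat_of_nonneg (by omega)
    have ekr : (((-k).toNat : ℕ) : ℝ) = -(k : ℝ) := by exact_mod_cast ek
    have h1n : 1 ≤ (-k).toNat := by omega
    have h5 : (-k).toNat ≤ 5 := by
      have : (((-k).toNat : ℕ) : ℝ) < 6 := by rw [ekr]; linarith only [hka'.1]
      exact_mod_cast Nat.lt_succ_iff.mp (by exact_mod_cast this : (-k).toNat < 6)
    have hcov' := hcov (-k).toNat h5 (‖yh - 0‖ ^ 2)
      (by rw [ekr]; have e : (-(k : ℝ)) ^ 2 = ((k : ℝ)) ^ 2 := by ring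
          rw [e]; exact hdist)
    have hR0 : 0 ≤ R (-k).toNat := (hP0' _ h5).trans (hP2 _ h5).2
    have hle : ‖yh - 0‖ ≤ R (-k).toNat := (pow_le_pow_iff_left₀ (norm_nonneg _) hR0 two_ne_zero).1 hcov'
    have ek' : -(((-k).toNat : ℕ) : ℤ) = k := by rw [ek, neg_neg]
    have := memDn (-k).toNat h1n h5 i j (by rw [ek', ← hyh]; exact hle)
    rwa [ek'] at this

/-! ### The stub -/

/-- **stub_ballPropagation** (η = 0, tree vocabulary of `FejesTothKissingTwelve.lean`: unit balls,
contact distance `2`).  FINITE-BALL LAYER PROPAGATION: if `u ∈ V`, `V` is a packing of unit balls,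
and every `v ∈ V` within distance `13` of `u` has its tangent arrangement `kissingShell V v`
arranged in the FCC or in the HCP pattern, then inside the closed `7`-ball about `u` the packing IS
a rigid image of a Barlow stacking `barlowStacking 2 (2√(2/3)) s`, `s` a Hägg sequence (Hales,
*Dense Sphere Packings* §1.3, cut down to a ball; whole-space version `HalesDSP_layerPackings_holds`).
Proof: Case A (`caseA`) with an HCP centre within `15/2` minimising `⌊3·dist²⌋`, else Case B
(`caseB`). [cite: HalesDSP2012, §1.3] -/
theorem stub_ballPropagation :
    ∀ (V : Set (EuclideanSpace ℝ (Fin 3))) (u : EuclideanSpace ℝ (Fin 3)), u ∈ V →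
      Literature.Geometry.DiscreteGeometry.IsUnitBallPacking V →
      (∀ v ∈ V, dist u v ≤ 13 →
        Literature.Geometry.DiscreteGeometry.IsArrangedIn
            (Literature.Geometry.DiscreteGeometry.kissingShell V v)
            Literature.Geometry.DiscreteGeometry.fccKissingPattern ∨
          Literature.Geometry.DiscreteGeometry.IsArrangedIn
            (Literature.Geometry.DiscreteGeometry.kissingShell V v)
            Literature.Geometry.DiscreteGeometry.hcpKissingPattern) →
      ∃ s : ℤ → ℤ, Literature.MathematicalPhysics.StatisticalMechanics.IsHaggSeq s ∧
        ∃ g : EuclideanSpace ℝ (Fin 3) ≃ᵢ EuclideanSpace ℝ (Fin 3),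
          V ∩ Metric.closedBall u 7 =
            g '' Literature.MathematicalPhysics.StatisticalMechanics.barlowStacking 2
              (2 * Real.sqrt (2 / 3)) s ∩ Metric.closedBall u 7 := by
  intro V u hu hV hpat
  classical
  by_cases hA : ∃ v ∈ V, dist u v ≤ 15 / 2 ∧ IsArrangedIn (kissingShell V v) hcpKissingPattern
  · -- Case A, with an almost-nearest HCP centre
    let p : ℕ → Prop := fun m => ∃ v ∈ V, dist u v ≤ 15 / 2 ∧
      IsArrangedIn (kissingShell V v) hcpKissingPattern ∧ ⌊3 * dist u v ^ 2⌋₊ = m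
    have hp : ∃ m, p m := by
      obtain ⟨v, hv, hd, harr⟩ := hA
      exact ⟨_, v, hv, hd, harr, rfl⟩
    obtain ⟨q, hq, hdq, harr, hqm⟩ := Nat.find_spec hp
    refine caseA hV hq hpat hdq harr fun v hv hdv harrv => ?_
    have hmin : Nat.find hp ≤ ⌊3 * dist u v ^ 2⌋₊ := Nat.find_min' hp ⟨v, hv, hdv, harrv, rfl⟩
    rw [← hqm] at hmin
    have h1 : (⌊3 * dist u q ^ 2⌋₊ : ℝ) ≤ ⌊3 * dist u v ^ 2⌋₊ := by exact_mod_cast hmin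
    have h2 : (⌊3 * dist u v ^ 2⌋₊ : ℝ) ≤ 3 * dist u v ^ 2 := Nat.floor_le (by positivity)
    have h3 : 3 * dist u q ^ 2 < ⌊3 * dist u q ^ 2⌋₊ + 1 := Nat.lt_floor_add_one _
    linarith
  · push Not at hA
    exact caseB hV hu hpat fun v hv hd harr => hA v hv hd harr


end Summit.AtomisticToContinuum.Crystallization.Theorems

end
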